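import Summits.BirchSwinnertonDyer.BirchSwinnertonDyer.Theorems.PrintCf2RubinValueTwoLinePinAlgebra
import Literature.NumberTheory.EllipticCurves.Rubin1991.TwoVariableCMLines
import Summits.BirchSwinnertonDyer.BirchSwinnertonDyer.Theorems.SignedBaseChangeTwistPairGreenbergProductDivisibilitySplitRationalAnchor
import HarnessLib

/-!
# M-LINE-PIN, file 2: the SOCKET for S3a-quad's two-variable equality — «⊗ℚ-form ∧ ONE line ⟹ equality», in the crux's currency

Cell `bsd-print-cf2`, width seat `bsd-line-cf2c-w8` g3 (prover-bsd-line-cf2c-w8-g3-0), planner bsd-print-cf2-plan g19's named piece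
M-LINE-PIN (2026-08-29T03:45:29Z), DECIDING crux `PrintCf2RubinValueTwo.TwoVariableMainConjAtSplitTwoQuad` (stmt-BirchSwinnertonDyer-24033).
`--supports stmt-BirchSwinnertonDyer-24033 --as helper`, Theses-free. HONEST FRAMING: a SOCKET — the crux's equality clause
`(charIdeal Λ₂ D.X).map (map (map J)) = span {G₂}` for ONE dual datum, from DISPLAYED hypotheses; none of the hypotheses is proved here;
no summit statement is proved by this seat; BSD is not proved by any of this. THEOREMS ONLY (no definition, no named fact, no `sorry`).

THE SOCKET (`map_charIdeal_eq_span_of_powForm_of_line`). Data of the crux: `D : DualData₂ κ₁ κ₂ M v̄ γ₁ γ₂` over `Λ₂ = ℤ₂⟦T₂⟧⟦T₁⟧`, a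
compatible coefficient map `J : ℤ₂ → 𝒪_{ℂ₂}`, the frame's two-variable measure `G₂ ∈ 𝒪_{ℂ₂}⟦T₂⟧⟦T₁⟧`. Hypotheses:
* (P) a generator `F` of `charIdeal Λ₂ D.X` (principal: `Λ₂` is a UFD — supplied by the consumer);
* (Q) the ⊗ℚ-FORM of the two-variable main conjecture: `(2^a · F^J) = (2^b · G₂)` in `𝒪_{ℂ₂}⟦T₂⟧⟦T₁⟧` for some `a b : ℕ` — what the
  four-term assembly of bricks (a)(b)(c)(d)(e) yields WITHOUT any μ-input (cf2c-w6 g2 BRICK-D-FOURTERM-PART2 §3,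
  `FourTerm.exists_charIdeal_mul_pow_eq_of_fourTerm_defects`), or JLK 2011 Thm. 5.2 ⊗ ℚ at `p = 2`;
* (L) ONE LINE: a ring map `φ : 𝒪_{ℂ₂}⟦T₂⟧⟦T₁⟧ → B` into a domain with `φ 2` a non-zero NON-unit, on which `(φ F^J) = (φ G₂)` with
  `φ F^J ≠ 0` — for Müller's `v`-line `φ = PowerSeries.map PowerSeries.constantCoeff` (`T₂ ↦ 0`, the `γ₂`-descent to the FIRST slot's
  line, §2; `¬ IsUnit (2 : 𝒪_{ℂ₂}⟦T⟧)` = `not_isUnit_two_powerSeries_padicComplexInt`), where (L) = [X-side control to the `v`-line]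
  ∧ [Müller 2020 Thm. 1.1/1.3 by name] ∧ [de Shalit II.4.12-type restriction of `G₂`] ∧ [S3n′ junk term trivial] (memo
  `Cruxes/TwoVariableMainConjAtSplitTwo/M-LINE-PIN-cf2c-w8g3.md`).
Conclusion: `a = b` (the μ-ambiguity dies) and the crux's clause for `D`. The algebra is file 1's
`LinePin.pow_eq_and_span_eq_of_span_pow_mul_eq_of_span_map_eq` (no units-reflection, no divisibility needed).
Also here: §1 the coefficient change `map (map J)` commutes with both line maps (so (L) can be produced over `ℤ₂` and transported), and
the `ℤ₂`-level socket `charIdeal_eq_span_of_powForm_of_firstLine_int` on `Λ₂ → Λ`. (`p ∈ 𝒪_{ℂ_p}` non-unit / `p ≠ 0` in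
`𝒪_{ℂ_p}⟦T₂⟧⟦T₁⟧` are REUSED from `SignedBaseChangeK1RationalAnchor` / BCS 2025 proofs; the K1 cell's ONE-SIDED cousin with a μ-input on the line is
`SignedBaseChangeK1RationalAnchor.map_le_span_of_rational_anchor`.)
presearch: Müller 2020 = [corpus: paper:arxiv-2002.05647 p0002–p0003] Thm. 1.1/1.3 read for the shape of (L); folklore algebra otherwise.
beyond-print theorem: no.

References: K. Müller, arXiv:2002.05647 (2020) Thm. 1.1, Thm. 1.3 [Mueller2020MCSplitTwo]; L. Washington, GTM 83 §13.2 [Washington1997];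
E. de Shalit (1987) II.4.12 [deShalit1987]; K. Rubin, Invent. Math. 103 (1991) §4 [Rubin1991].
-/

set_option autoImplicit false
-- the summit namespace `Summit.BirchSwinnertonDyer.BirchSwinnertonDyer` repeats the problem name by design (D-0017)
set_option linter.dupNamespace false

noncomputable section

open scoped Classical

namespace Summit.BirchSwinnertonDyer.BirchSwinnertonDyer.Theorems.PrintCf2.LinePin

open Literature.NumberTheory.EllipticCurves

/-! ## §1. Coefficient change commutes with the two line maps; `2` is a non-zero non-unit on the `𝒪_{ℂ₂}`-line -/

section CoeffChange

variable {R S : Type*} [CommRing R] [CommRing S] (J : R →+* S)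

/-- Inner line `T₂ ↦ 0` commutes with coefficient change: `(F^J)(T₁, 0) = (F(T₁, 0))^J`. [folklore] -/
theorem map_constantCoeff_map_map (F : PowerSeries (PowerSeries R)) :
    PowerSeries.map (PowerSeries.constantCoeff (R := S)) (PowerSeries.map (PowerSeries.map J) F) =
      PowerSeries.map J (PowerSeries.map (PowerSeries.constantCoeff (R := R)) F) := by
  ext n
  simp only [PowerSeries.coeff_map, ← PowerSeries.coeff_zero_eq_constantCoeff_apply]

/-- Outer line `T₁ ↦ 0` commutes with coefficient change: `(F^J)(0, T₂) = (F(0, T₂))^J`. [folklore] -/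
theorem constantCoeff_map_map (F : PowerSeries (PowerSeries R)) :
    PowerSeries.constantCoeff (PowerSeries.map (PowerSeries.map J) F) =
      PowerSeries.map J (PowerSeries.constantCoeff F) := by
  rw [← PowerSeries.coeff_zero_eq_constantCoeff_apply, PowerSeries.coeff_map, PowerSeries.coeff_zero_eq_constantCoeff_apply]

end CoeffChange

section TwoAdic

variable {p : ℕ} [Fact p.Prime]

/-- `p` is a non-zero NON-unit of the one-variable line `𝒪_{ℂ_p}⟦T⟧` (constant term `p`). [folklore] -/
theorem natCast_ne_zero_and_not_isUnit_powerSeries_padicComplexInt :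
    ((p : ℕ) : PowerSeries (PadicComplexInt p)) ≠ 0 ∧ ¬ IsUnit ((p : ℕ) : PowerSeries (PadicComplexInt p)) := by
  refine ⟨fun h ↦ natCast_prime_padicComplexInt_ne_zero (p := p) ?_,
    fun h ↦ SignedBaseChangeK1RationalAnchor.not_isUnit_natCast_padicComplexInt (p := p) ?_⟩
  · have := congrArg (PowerSeries.constantCoeff (R := PadicComplexInt p)) h
    rwa [map_natCast, map_zero] at this
  · have := PowerSeries.isUnit_constantCoeff _ h
    rwa [map_natCast] at this

end TwoAdic

/-! ## §2. The socket in S3a-quad's currency -/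

section Socket

open Literature.NumberTheory.GaloisRepresentations NumberField IsDedekindDomain Field

universe u

variable {K : Type u} [Field K] [NumberField K] {p : ℕ} [Fact p.Prime] {κ₁ κ₂ : ZpExtension K p}
  {M : Type u} [AddCommGroup M] [DistribMulAction (absoluteGaloisGroup K) M] [TopologicalSpace M] [DiscreteTopology M]
  {vbar : HeightOneSpectrum (𝓞 K)} {γ₁ γ₂ : absoluteGaloisGroup K}

/-- **M-LINE-PIN SOCKET (any line).** For a two-variable dual datum `D`, a coefficient map `J : ℤ_p → 𝒪_{ℂ_p}`, the measure `G₂` and a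
generator `F` of `charIdeal Λ₂ D.X` (P): the ⊗ℚ-form «`(p^a · F^J) = (p^b · G₂)`» (Q) together with the equality `(φ F^J) = (φ G₂)`,
`φ F^J ≠ 0`, on ONE ring map `φ` into a domain where `φ p` is a non-zero non-unit (L) give `a = b` and the crux's clause
`(charIdeal Λ₂ D.X).map (map (map J)) = (G₂)`. [cite: Washington1997, §13.2 (shape only)] [cite: Mueller2020MCSplitTwo, Thm. 1.1 and Thm. 1.3 (the line input)] -/
theorem map_charIdeal_eq_span_of_powForm_of_line (D : DualData₂ κ₁ κ₂ M vbar γ₁ γ₂)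
    (J : ℤ_[p] →+* PadicComplexInt p) (G₂ : PowerSeries (PowerSeries (PadicComplexInt p)))
    (F : IwasawaAlgebra₂ p) (hF : Module.charIdeal (IwasawaAlgebra₂ p) D.X = Ideal.span {F})
    {a b : ℕ} (hQ : Ideal.span ({((p : ℕ) : PowerSeries (PowerSeries (PadicComplexInt p))) ^ a *
        PowerSeries.map (PowerSeries.map J) F} : Set (PowerSeries (PowerSeries (PadicComplexInt p)))) =
      Ideal.span {((p : ℕ) : PowerSeries (PowerSeries (PadicComplexInt p))) ^ b * G₂})
    {B : Type*} [CommRing B] [IsDomain B] (φ : PowerSeries (PowerSeries (PadicComplexInt p)) →+* B)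
    (hφp0 : φ (p : ℕ) ≠ 0) (hφp : ¬ IsUnit (φ (p : ℕ)))
    (hline : Ideal.span ({φ (PowerSeries.map (PowerSeries.map J) F)} : Set B) = Ideal.span {φ G₂})
    (hF0 : φ (PowerSeries.map (PowerSeries.map J) F) ≠ 0) :
    a = b ∧ (Module.charIdeal (IwasawaAlgebra₂ p) D.X).map (PowerSeries.map (PowerSeries.map J)) = Ideal.span {G₂} := by
  obtain ⟨hab, hspan⟩ := pow_eq_and_span_eq_of_span_pow_mul_eq_of_span_map_eq φ
    SignedBaseChangeK1RationalAnchor.natCast_ne_zero₂ hφp0 hφp hQ hline hF0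
  refine ⟨hab, ?_⟩
  rw [hF, map_span_singleton]
  exact hspan

/-- **M-LINE-PIN SOCKET, FIRST SLOT'S LINE (`T₂ ↦ 0`, Müller's `v`-line when `κ₁` is THE line unramified outside `v`).** The line map is
`PowerSeries.map PowerSeries.constantCoeff : 𝒪_{ℂ_p}⟦T₂⟧⟦T₁⟧ → 𝒪_{ℂ_p}⟦T₁⟧` (a domain on which `p` is a non-zero non-unit); the line
hypothesis reads `((F(T₁,0))^J) = (G₂(T₁,0))` (coefficient change commutes with the line map, `map_constantCoeff_map_map`).
[cite: Mueller2020MCSplitTwo, Thm. 1.1 and Thm. 1.3] [cite: deShalit1987, II.4.12] -/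
theorem map_charIdeal_eq_span_of_powForm_of_firstLine (D : DualData₂ κ₁ κ₂ M vbar γ₁ γ₂)
    (J : ℤ_[p] →+* PadicComplexInt p) (G₂ : PowerSeries (PowerSeries (PadicComplexInt p)))
    (F : IwasawaAlgebra₂ p) (hF : Module.charIdeal (IwasawaAlgebra₂ p) D.X = Ideal.span {F})
    {a b : ℕ} (hQ : Ideal.span ({((p : ℕ) : PowerSeries (PowerSeries (PadicComplexInt p))) ^ a *
        PowerSeries.map (PowerSeries.map J) F} : Set (PowerSeries (PowerSeries (PadicComplexInt p)))) =
      Ideal.span {((p : ℕ) : PowerSeries (PowerSeries (PadicComplexInt p))) ^ b * G₂})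
    (hline : Ideal.span ({PowerSeries.map J (PowerSeries.map (PowerSeries.constantCoeff (R := ℤ_[p])) F)} :
        Set (PowerSeries (PadicComplexInt p))) =
      Ideal.span {PowerSeries.map (PowerSeries.constantCoeff (R := PadicComplexInt p)) G₂})
    (hF0 : PowerSeries.map J (PowerSeries.map (PowerSeries.constantCoeff (R := ℤ_[p])) F) ≠ 0) :
    a = b ∧ (Module.charIdeal (IwasawaAlgebra₂ p) D.X).map (PowerSeries.map (PowerSeries.map J)) = Ideal.span {G₂} := by
  refine map_charIdeal_eq_span_of_powForm_of_line D J G₂ F hF hQ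
    (PowerSeries.map (PowerSeries.constantCoeff (R := PadicComplexInt p))) ?_ ?_ ?_ ?_
  · rw [map_natCast]; exact natCast_ne_zero_and_not_isUnit_powerSeries_padicComplexInt.1
  · rw [map_natCast]; exact natCast_ne_zero_and_not_isUnit_powerSeries_padicComplexInt.2
  · rwa [map_constantCoeff_map_map]
  · rwa [map_constantCoeff_map_map]

/-- **M-LINE-PIN SOCKET, SECOND SLOT'S LINE (`T₁ ↦ 0`, the S3b′ descent `PowerSeries.constantCoeff`).** Same with the outer variable.
[cite: Washington1997, §13.2 (shape only)] -/
theorem map_charIdeal_eq_span_of_powForm_of_secondLine (D : DualData₂ κ₁ κ₂ M vbar γ₁ γ₂)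
    (J : ℤ_[p] →+* PadicComplexInt p) (G₂ : PowerSeries (PowerSeries (PadicComplexInt p)))
    (F : IwasawaAlgebra₂ p) (hF : Module.charIdeal (IwasawaAlgebra₂ p) D.X = Ideal.span {F})
    {a b : ℕ} (hQ : Ideal.span ({((p : ℕ) : PowerSeries (PowerSeries (PadicComplexInt p))) ^ a *
        PowerSeries.map (PowerSeries.map J) F} : Set (PowerSeries (PowerSeries (PadicComplexInt p)))) =
      Ideal.span {((p : ℕ) : PowerSeries (PowerSeries (PadicComplexInt p))) ^ b * G₂})
    (hline : Ideal.span ({PowerSeries.map J (PowerSeries.constantCoeff F)} : Set (PowerSeries (PadicComplexInt p))) =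
      Ideal.span {PowerSeries.constantCoeff G₂})
    (hF0 : PowerSeries.map J (PowerSeries.constantCoeff F) ≠ 0) :
    a = b ∧ (Module.charIdeal (IwasawaAlgebra₂ p) D.X).map (PowerSeries.map (PowerSeries.map J)) = Ideal.span {G₂} := by
  refine map_charIdeal_eq_span_of_powForm_of_line D J G₂ F hF hQ
    (PowerSeries.constantCoeff (R := PowerSeries (PadicComplexInt p))) ?_ ?_ ?_ ?_
  · rw [map_natCast]; exact natCast_ne_zero_and_not_isUnit_powerSeries_padicComplexInt.1
  · rw [map_natCast]; exact natCast_ne_zero_and_not_isUnit_powerSeries_padicComplexInt.2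
  · rwa [constantCoeff_map_map]
  · rwa [constantCoeff_map_map]

/-- **`ℤ_p`-level socket on `Λ₂ → Λ` (first slot's line)**, for consumers who pin BEFORE the coefficient change: `(p^a F) = (p^b G)` in
`Λ₂`, `(F(T₁,0)) = (G(T₁,0))` in `Λ`, `F(T₁,0) ≠ 0` ⟹ `a = b ∧ (charIdeal Λ₂ D.X) = (G)`. [cite: Washington1997, §13.2 (shape only)] -/
theorem charIdeal_eq_span_of_powForm_of_firstLine_int (D : DualData₂ κ₁ κ₂ M vbar γ₁ γ₂) (F G : IwasawaAlgebra₂ p)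
    (hF : Module.charIdeal (IwasawaAlgebra₂ p) D.X = Ideal.span {F}) {a b : ℕ}
    (hQ : Ideal.span ({((p : ℕ) : IwasawaAlgebra₂ p) ^ a * F} : Set (IwasawaAlgebra₂ p)) =
      Ideal.span {((p : ℕ) : IwasawaAlgebra₂ p) ^ b * G})
    (hline : Ideal.span ({PowerSeries.map (PowerSeries.constantCoeff (R := ℤ_[p])) F} : Set (IwasawaAlgebra p)) =
      Ideal.span {PowerSeries.map (PowerSeries.constantCoeff (R := ℤ_[p])) G})
    (hF0 : PowerSeries.map (PowerSeries.constantCoeff (R := ℤ_[p])) F ≠ 0) :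
    a = b ∧ Module.charIdeal (IwasawaAlgebra₂ p) D.X = Ideal.span {G} := by
  obtain ⟨hab, h⟩ := pow_eq_and_span_eq_of_mapConstantCoeff hQ hline hF0
  exact ⟨hab, hF.trans h⟩

end Socket

end Summit.BirchSwinnertonDyer.BirchSwinnertonDyer.Theorems.PrintCf2.LinePin

end
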